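import Summits.QuantumAdvantage.QuantumAdvantage.Theorems.CubicForrelationNearExactIsExactTwelveTypeOWindow
import Summits.QuantumAdvantage.QuantumAdvantage.Theorems.CubicForrelationNearExactIsExactTwelveLevelSixLt

/-!
# Crux `CubicForrelation.NearExactIsExact` (stmt-QuantumAdvantage-14043) — n = 12: inside the window top `59/64 < Φ < 1` BOTH sides are at
  level exactly 5 (structure theorem)

Certificate seat `b2b-cforr-cert` (gen 13).  HONEST FRAMING: a kernel-checked STRUCTURE THEOREM (standard axioms) about cubic Boolean pairs on
12 bits; it does not move `θ₁₂` (certified `< 953/1024`, `isolation_twelve_953`; witnessed `≥ 57/64`) and is NOT summit progress.  It says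
where the eight candidate values `945/1024, …, 952/1024` above `59/64` would have to live.

THEOREM `window_twelve_levelFive`: cubic `f, g : 𝔽₂¹² → 𝔽₂` with `59/64 < Φ(f,g) < 1` ⇒ every Walsh value of `g` AND of `f` lies in `32ℤ`
and on EACH side some Walsh value is an odd multiple of `32` (both sides at level exactly 5 of the 2-adic tower: `{W/32 odd}` is then an
affine hyperplane, `stub_walshTower`).  Ingredients: type O ⇒ `Φ ≤ 59/64` (`to12_window_typeE`, gen 12) and level `≥ 6` ⇒ `Φ = 1`
above `59/64` (`tw6_levelSix_lt`, this generation), applied to `(f,g)` and to `(g,f)` (`forrelation_comm`).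

WHAT IS OPEN: whether a level-5 × level-5 cubic pair on 12 bits can have `Φ ∈ (944, 953)/1024`; at `952/1024` the residual configuration
surviving every step in the tree is a wild 5-flat `Ω ⊂ {W_g/32 odd}` carrying `u' − 2(−1)^f = −3σ` (cost `32·8 = 256`), see
`…TwelveLevelFiveEngine.lean`.

References: Ax (1964) / McEliece (1972); MacWilliams–Sloane (1977) Ch. 13–15; Carlet (2021); O'Donnell (2014) §3.3.
-/

set_option linter.dupNamespace false -- D-0017: single-problem summit ⇒ `QuantumAdvantage.QuantumAdvantage` by design

noncomputable section

namespace Summit.QuantumAdvantage.QuantumAdvantage.Theorems.CubicForrelation.NearExactIsExact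

open Finset
open Literature.Computability.QuantumComplexity
open Literature.Computability.QuantumComplexity.DerivativeWalsh (W)

/-- One side: in the window top the spectrum of `g` lies in `32ℤ` but not in `64ℤ`. [this work] -/
theorem window_twelve_levelFive_side (f g : (Fin (6 + 6) → Bool) → Bool) (hf : IsDegLeFun 3 f) (hg : IsDegLeFun 3 g)
    (hlo : (59 / 64 : ℝ) < forrelation f g) (hlt : forrelation f g < 1) :
    (∀ x, ∃ k : ℤ, W (fun y => signOf (g y)) x = 32 * (k : ℝ)) ∧
      ∃ x, ∃ k : ℤ, W (fun y => signOf (g y)) x = 32 * (2 * (k : ℝ) + 1) := by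
  obtain ⟨hgE, -⟩ := to12_window_typeE f g hf hg hlo
  refine ⟨hgE, ?_⟩
  choose u' hu' using hgE
  have hu'5 : ∀ x, W (fun y => signOf (g y)) x = (2 : ℝ) ^ 5 * (u' x : ℝ) := fun x => (hu' x).trans (by norm_num)
  by_contra hne
  push Not at hne
  have heven : ∀ x, ¬ Odd (u' x) := by
    rintro x ⟨k, hk⟩
    exact hne x k (by rw [hu' x, hk]; push_cast; ring)
  have hu6 := tw_level_up g u' hu'5 heven
  have h1 := tw6_levelSix_lt f g hf hg (fun x => u' x / 2) (fun x => (hu6 x).trans (by norm_num)) hlo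
  linarith

/-- **Inside the window top `59/64 < Φ < 1`, BOTH sides of a cubic pair on 12 bits are at level exactly 5**: all Walsh values in `32ℤ`,
some Walsh value `≡ 32 (mod 64)`, on each side.  Structure theorem; NOT summit progress. [this work] -/
theorem window_twelve_levelFive (f g : (Fin (6 + 6) → Bool) → Bool) (hf : IsDegLeFun 3 f) (hg : IsDegLeFun 3 g)
    (hlo : (59 / 64 : ℝ) < forrelation f g) (hlt : forrelation f g < 1) :
    ((∀ x, ∃ k : ℤ, W (fun y => signOf (g y)) x = 32 * (k : ℝ)) ∧
      ∃ x, ∃ k : ℤ, W (fun y => signOf (g y)) x = 32 * (2 * (k : ℝ) + 1)) ∧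
    ((∀ x, ∃ k : ℤ, W (fun y => signOf (f y)) x = 32 * (k : ℝ)) ∧
      ∃ x, ∃ k : ℤ, W (fun y => signOf (f y)) x = 32 * (2 * (k : ℝ) + 1)) := by
  refine ⟨window_twelve_levelFive_side f g hf hg hlo hlt, window_twelve_levelFive_side g f hg hf ?_ ?_⟩
  · rwa [Summit.QuantumAdvantage.QuantumAdvantage.Theorems.SignedCubicForrelationNotPrBPP.Negative.HalfQuad.forrelation_comm]
  · rwa [Summit.QuantumAdvantage.QuantumAdvantage.Theorems.SignedCubicForrelationNotPrBPP.Negative.HalfQuad.forrelation_comm]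

/-- The same at the literal type `Fin 12`. NOT summit progress. [this work] -/
theorem window_twelve_levelFive' : ∀ f g : (Fin 12 → Bool) → Bool, IsDegLeFun 3 f → IsDegLeFun 3 g →
    (59 / 64 : ℝ) < forrelation f g → forrelation f g < 1 →
    ((∀ x, ∃ k : ℤ, W (fun y => signOf (g y)) x = 32 * (k : ℝ)) ∧
      ∃ x, ∃ k : ℤ, W (fun y => signOf (g y)) x = 32 * (2 * (k : ℝ) + 1)) ∧
    ((∀ x, ∃ k : ℤ, W (fun y => signOf (f y)) x = 32 * (k : ℝ)) ∧
      ∃ x, ∃ k : ℤ, W (fun y => signOf (f y)) x = 32 * (2 * (k : ℝ) + 1)) :=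
  fun f g hf hg hlo hlt => window_twelve_levelFive f g hf hg hlo hlt

end Summit.QuantumAdvantage.QuantumAdvantage.Theorems.CubicForrelation.NearExactIsExact

end
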